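import Literature.Topology.PlaneTopology.CrosscutProofs
import Literature.Topology.PlaneTopology.SimpleArcs
import Literature.Probability.RandomPlanarGeometry.ArcHullDomains
import HarnessLib

/-!
# Outer squeezes, part 1: biting a Dobrushin domain along a cross-cut

Support file (`--supports stmt-CriticalPhenomena-0773`, towards the registered stub `stub_squeezeFamily`,
geometry F of composition 2 `RestrictionOfLimit_of_squeeze`) of the line `birth` for the crux
`RestrictionOfLimit`.

Pure plane topology. A **bite** of a Dobrushin domain `(E; a, b)` is a closed set `T ∌ a, b` containing a
cross-cut `L` of `E` (a simple arc from `p` to `q`, `p ≠ q ∈ ∂E`, interior in `E`) such that the part of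
`T` inside `E` and off `L` is a nonempty open connected set `B`. Newman's cross-cut theorem (tree:
`Newman1939_crosscut_holds`) splits `E ∖ L` into two Jordan domains `U₁ ⊔ U₂` bounded by `L` and the two
boundary arcs; `B` is clopen in `E ∖ L`, so it IS one of them, the one whose frontier misses `a`; hence
`E ∖ T` is the other one, a Jordan domain whose boundary loop (`L` followed by a boundary arc of `E`)
still passes through `a` and `b`: re-parametrised to start at `a` it is a Dobrushin domain with the same
marked points (`exists_dobrushin_carrier_eq_diff`). Finitely many pairwise disjoint bites are removed one
after the other (`exists_dobrushin_carrier_eq_diff_biUnion`).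

References: M. H. A. Newman, *Elements of the topology of plane sets of points* (1939), Ch. V §11,
Thms 11·7–11·8 (cross-cuts). No named fact beyond the discharged ones; axioms `propext`, `Classical.choice`,
`Quot.sound`.
-/

noncomputable section

open Set Filter Topology Metric
open Literature.Topology.PlaneTopology Literature.Probability.RandomPlanarGeometry

namespace Summit.CriticalPhenomena.SAWScalingLimit.Theorems.RestrictionOfLimit.Birth

/-! ### A Jordan loop through the two marked points gives a Dobrushin domain -/

/-- **Re-marking a Jordan domain.** An open bounded connected `V` whose frontier is the range of a
continuous `1`-periodic loop injective on a period, passing through two distinct points `a`, `b`, is the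
carrier of a Dobrushin domain with marked points `a`, `b` (shift the loop to start at `a`). [folklore] -/
theorem exists_dobrushin_of_loop {V : Set ℂ} {γ : ℝ → ℂ} {a b : ℂ} (hVo : IsOpen V)
    (hVb : Bornology.IsBounded V) (hVc : IsConnected V) (hγc : Continuous γ) (hγp : Function.Periodic γ 1)
    (hγi : InjOn γ (Ico 0 1)) (hfr : frontier V = range γ) (ha : a ∈ range γ) (hb : b ∈ range γ)
    (hab : a ≠ b) :
    ∃ E : DobrushinDomain, E.carrier = V ∧ E.pt 0 = a ∧ E.pt 1 = b := by
  obtain ⟨ta, hta⟩ := ha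
  obtain ⟨tb, htb⟩ := hb
  have hfract : 0 < Int.fract (tb - ta) := by
    rcases (Int.fract_nonneg (tb - ta)).lt_or_eq with h | h
    · exact h
    · exfalso
      apply hab
      have h1 : γ (Int.fract (tb - ta) + ta) = γ tb := by
        rw [Int.fract, show tb - ta - (⌊tb - ta⌋ : ℝ) + ta = tb - (⌊tb - ta⌋ : ℝ) * 1 by ring]
        exact hγp.sub_int_mul_eq ⌊tb - ta⌋
      rw [← h, zero_add, hta, htb] at h1
      exact h1
  let E : DobrushinDomain :=
    { carrier := V
      boundary := fun t ↦ γ (t + ta)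
      isOpen := hVo
      isBounded := hVb
      isConnected := hVc
      continuous_boundary := hγc.comp (continuous_id.add continuous_const)
      periodic_boundary := fun t ↦ by
        show γ (t + 1 + ta) = γ (t + ta)
        rw [add_right_comm]
        exact hγp (t + ta)
      injOn_boundary := hγp.injOn_shift hγi ta
      range_boundary := by rw [range_comp_add_right γ ta, hfr]
      mark := ![0, Int.fract (tb - ta)]
      strictMono_mark := by
        refine Fin.strictMono_iff_lt_succ.2 fun k ↦ ?_
        fin_cases k
        simpa using hfract
      mark_mem := fun k ↦ by
        fin_cases k
        · simp
        · exact ⟨Int.fract_nonneg (tb - ta), Int.fract_lt_one (tb - ta)⟩ }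
  refine ⟨E, rfl, ?_, ?_⟩
  · show γ (0 + ta) = a
    rw [zero_add, hta]
  · show γ (Int.fract (tb - ta) + ta) = b
    rw [Int.fract, show tb - ta - (⌊tb - ta⌋ : ℝ) + ta = tb - (⌊tb - ta⌋ : ℝ) * 1 by ring,
      hγp.sub_int_mul_eq ⌊tb - ta⌋, htb]

/-- A marked point outside the closed bite `T` lies on the frontier of `E ∖ T`. [folklore] -/
theorem pt_mem_frontier_diff (E : DobrushinDomain) {T : Set ℂ} (hT : IsClosed T) (i : Fin 2)
    (hi : E.pt i ∉ T) : E.pt i ∈ frontier (E.carrier \ T) := by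
  have hfr : E.pt i ∈ frontier E.carrier := E.boundary_mem_frontier _
  have hnot : E.pt i ∉ E.carrier := fun h ↦ by
    have := hfr.2
    rw [E.isOpen.interior_eq] at this
    exact this h
  refine ⟨?_, fun h ↦ hnot (interior_subset h).1⟩
  rw [mem_closure_iff_nhds]
  intro N hN
  have hN' : N ∩ Tᶜ ∈ 𝓝 (E.pt i) := inter_mem hN (hT.isOpen_compl.mem_nhds hi)
  obtain ⟨z, hzN, hzE⟩ := mem_closure_iff_nhds.1 hfr.1 _ hN'
  exact ⟨z, hzN.1, hzE, hzN.2⟩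

/-- **Core of the bite lemma.** If `E ∖ T = V` is open and connected with frontier the θ-free union of a
simple arc `L ⊆ T` from `x` to `y` and a simple arc `A` from `y` back to `x` meeting `L` only at the
end-points, and the marked points avoid the closed set `T`, then `E ∖ T` carries a Dobrushin domain with
the same marked points. [folklore] -/
theorem exists_dobrushin_carrier_eq_of_frontier (E : DobrushinDomain) {T V L A : Set ℂ} {x y : ℂ}
    (hT : IsClosed T) (haT : E.pt 0 ∉ T) (hbT : E.pt 1 ∉ T) (hVo : IsOpen V) (hVc : IsConnected V)
    (hVE : E.carrier \ T = V) (hL : IsSimpleArc L x y) (hA : IsSimpleArc A y x) (hLA : L ∩ A ⊆ {x, y})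
    (hfr : frontier V = L ∪ A) :
    ∃ E' : DobrushinDomain, E'.carrier = E.carrier \ T ∧ E'.pt 0 = E.pt 0 ∧ E'.pt 1 = E.pt 1 := by
  obtain ⟨γ, hγc, hγp, hγi, hγr⟩ := hL.exists_periodic_of_union hA hLA
  have hfr' : frontier V = range γ := by rw [hfr, hγr]
  have ha : E.pt 0 ∈ range γ := by
    rw [← hfr', ← hVE]; exact pt_mem_frontier_diff E hT 0 haT
  have hb : E.pt 1 ∈ range γ := by
    rw [← hfr', ← hVE]; exact pt_mem_frontier_diff E hT 1 hbT
  have hab : E.pt 0 ≠ E.pt 1 := fun h ↦ by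
    have := E.pt_injective h
    exact absurd this (by decide)
  have hVb : Bornology.IsBounded V := E.isBounded.subset (hVE ▸ sdiff_subset)
  obtain ⟨E', h1, h2, h3⟩ := exists_dobrushin_of_loop hVo hVb hVc hγc hγp hγi hfr' ha hb hab
  exact ⟨E', h1.trans hVE.symm, h2, h3⟩

/-- **The bite lemma.** Let `(E; a, b)` be a Dobrushin domain, `T ∌ a, b` a closed set containing a simple
arc `L` from `p` to `q` with `p, q ∈ ∂E` and `L ∖ {p, q} ⊆ E` (a cross-cut), such that
`B = (E ∩ T) ∖ L` is nonempty, open and connected. Then `E ∖ T` is the carrier of a Dobrushin domain with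
marked points `a`, `b`. (Newman: `E ∖ L = U₁ ⊔ U₂`; `B` is clopen in `E ∖ L` hence equal to the `Uᵢ` whose
frontier misses `a`; `E ∖ T` is the other one.) [folklore] -/
theorem exists_dobrushin_carrier_eq_diff (E : DobrushinDomain) {T L : Set ℂ} {p q : ℂ}
    (hT : IsClosed T) (haT : E.pt 0 ∉ T) (hbT : E.pt 1 ∉ T) (hLT : L ⊆ T) (hL : IsSimpleArc L p q)
    (hp : p ∈ frontier E.carrier) (hq : q ∈ frontier E.carrier) (hLE : L \ {p, q} ⊆ E.carrier)
    (hBo : IsOpen ((E.carrier ∩ T) \ L)) (hBc : IsConnected ((E.carrier ∩ T) \ L)) :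
    ∃ E' : DobrushinDomain, E'.carrier = E.carrier \ T ∧ E'.pt 0 = E.pt 0 ∧ E'.pt 1 = E.pt 1 := by
  have hpq : p ≠ q := hL.ne
  -- parameters of the end-points
  rw [← E.range_boundary] at hp hq
  obtain ⟨s, rfl⟩ := hp
  obtain ⟨t', rfl⟩ := hq
  set t : ℝ := s + Int.fract (t' - s) with ht_def
  have hqt : E.boundary t = E.boundary t' := by
    rw [ht_def, Int.fract, show s + (t' - s - (⌊t' - s⌋ : ℝ)) = t' - (⌊t' - s⌋ : ℝ) * 1 by ring]
    exact E.periodic_boundary.sub_int_mul_eq ⌊t' - s⌋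
  have hst : s < t := by
    rcases (Int.fract_nonneg (t' - s)).lt_or_eq with h | h
    · rw [ht_def]; linarith
    · exfalso
      apply hpq
      rw [← hqt, ht_def, ← h, add_zero]
  have hts : t < s + 1 := by
    rw [ht_def]; linarith [Int.fract_lt_one (t' - s)]
  rw [← hqt] at hL hLE hpq
  -- Newman's cross-cut theorem
  have hcross : E.IsCrosscut L (E.boundary s) (E.boundary t) :=
    ⟨hL, E.boundary_mem_frontier s, E.boundary_mem_frontier t, hpq, hLE⟩
  obtain ⟨U₁, U₂, hU₁o, hU₂o, hU₁c, hU₂c, hdisj, hunion, hfr₁, hfr₂⟩ :=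
    Newman1939_crosscut_holds E.toJordanDomain L s t hst hts hcross
  set B : Set ℂ := (E.carrier ∩ T) \ L with hB_def
  have hBsub : B ⊆ U₁ ∪ U₂ := by
    rw [hunion]
    exact fun z hz ↦ ⟨hz.1.1, hz.2⟩
  -- `B` fills any of the two sides it meets
  have hfill : ∀ U : Set ℂ, IsOpen U → IsConnected U → U ⊆ E.carrier \ L → B ⊆ U → U = B := by
    intro U hUo hUc hUsub hBU
    refine Subset.antisymm ?_ hBU
    have hOo : IsOpen (U \ T) := hUo.sdiff hT
    have hcover : U ⊆ B ∪ (U \ T) := fun z hz ↦ by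
      by_cases hzT : z ∈ T
      · exact Or.inl ⟨⟨(hUsub hz).1, hzT⟩, (hUsub hz).2⟩
      · exact Or.inr ⟨hz, hzT⟩
    have hdisj' : Disjoint B (U \ T) := Set.disjoint_left.2 fun z hz hz' ↦ hz'.2 hz.1.2
    rcases hUc.isPreconnected.subset_or_subset hBo hOo hdisj' hcover with h | h
    · exact h
    · exfalso
      obtain ⟨z, hz⟩ := hBc.nonempty
      exact (h (hBU hz)).2 hz.1.2
  have hclB : closure B ⊆ T := closure_minimal (fun z hz ↦ hz.1.2) hT
  -- the arcs `L ∩ boundary-arc ⊆ end-points`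
  have hLarc : ∀ u v : ℝ, L ∩ E.boundary '' Icc u v ⊆ {E.boundary s, E.boundary t} := by
    intro u v z hz
    by_contra hzn
    have hzE : z ∈ E.carrier := hLE ⟨hz.1, hzn⟩
    have hzfr : z ∈ frontier E.carrier := by
      rw [← E.range_boundary]
      obtain ⟨w, -, hw⟩ := hz.2
      exact ⟨w, hw⟩
    have := hzfr.2
    rw [E.isOpen.interior_eq] at this
    exact this hzE
  have hs1 : E.boundary (s + 1) = E.boundary s := E.periodic_boundary s
  rcases hBc.isPreconnected.subset_or_subset hU₁o hU₂o hdisj hBsub with h | h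
  · -- `B = U₁`, keep `U₂`
    have hU₁B : U₁ = B := hfill U₁ hU₁o hU₁c (hunion ▸ subset_union_left) h
    have hVE : E.carrier \ T = U₂ := by
      ext z
      constructor
      · rintro ⟨hzE, hzT⟩
        have hz : z ∈ U₁ ∪ U₂ := by rw [hunion]; exact ⟨hzE, fun hzL ↦ hzT (hLT hzL)⟩
        rcases hz with hz | hz
        · rw [hU₁B] at hz; exact absurd hz.1.2 hzT
        · exact hz
      · intro hz
        have hz' : z ∈ E.carrier \ L := by rw [← hunion]; exact Or.inr hz
        refine ⟨hz'.1, fun hzT ↦ ?_⟩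
        have hzB : z ∈ U₁ := by rw [hU₁B]; exact ⟨⟨hz'.1, hzT⟩, hz'.2⟩
        exact Set.disjoint_left.1 hdisj hzB hz
    have hA : IsSimpleArc (E.boundary '' Icc t (s + 1)) (E.boundary t) (E.boundary s) := by
      have := E.isSimpleArc_image_boundary hts (by linarith)
      rwa [hs1] at this
    exact exists_dobrushin_carrier_eq_of_frontier E hT haT hbT hU₂o hU₂c hVE hL hA (hLarc _ _) hfr₂
  · -- `B = U₂`, keep `U₁`
    have hU₂B : U₂ = B := hfill U₂ hU₂o hU₂c (hunion ▸ subset_union_right) h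
    have hVE : E.carrier \ T = U₁ := by
      ext z
      constructor
      · rintro ⟨hzE, hzT⟩
        have hz : z ∈ U₁ ∪ U₂ := by rw [hunion]; exact ⟨hzE, fun hzL ↦ hzT (hLT hzL)⟩
        rcases hz with hz | hz
        · exact hz
        · rw [hU₂B] at hz; exact absurd hz.1.2 hzT
      · intro hz
        have hz' : z ∈ E.carrier \ L := by rw [← hunion]; exact Or.inl hz
        refine ⟨hz'.1, fun hzT ↦ ?_⟩
        have hzB : z ∈ U₂ := by rw [hU₂B]; exact ⟨⟨hz'.1, hzT⟩, hz'.2⟩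
        exact Set.disjoint_left.1 hdisj hz hzB
    have hA : IsSimpleArc (E.boundary '' Icc s t) (E.boundary s) (E.boundary t) :=
      E.isSimpleArc_image_boundary hst hts
    have hLA : L ∩ E.boundary '' Icc s t ⊆ {E.boundary t, E.boundary s} := by
      rw [Set.pair_comm]; exact hLarc _ _
    exact exists_dobrushin_carrier_eq_of_frontier E hT haT hbT hU₁o hU₁c hVE hL.symm hA hLA hfr₁

/-- **Finitely many disjoint bites.** Remove from a Dobrushin domain `(D; a, b)` finitely many pairwise
disjoint closed bites `T i ∌ a, b`, each containing a simple arc `L i` from `p i` to `q i` with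
`p i, q i ∉ D` adherent to the nonempty open connected set `(D ∩ T i) ∖ L i` and `L i ∖ {p i, q i} ⊆ D`:
the result `D ∖ ⋃ T i` carries a Dobrushin domain with marked points `a`, `b` (induction on the number of
bites, `exists_dobrushin_carrier_eq_diff`). [folklore] -/
theorem exists_dobrushin_carrier_eq_diff_biUnion {ι : Type*} (D : DobrushinDomain) (S : Finset ι)
    (T L : ι → Set ℂ) (p q : ι → ℂ) (hT : ∀ i ∈ S, IsClosed (T i)) (ha : ∀ i ∈ S, D.pt 0 ∉ T i)
    (hb : ∀ i ∈ S, D.pt 1 ∉ T i) (hLT : ∀ i ∈ S, L i ⊆ T i)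
    (hL : ∀ i ∈ S, IsSimpleArc (L i) (p i) (q i)) (hpD : ∀ i ∈ S, p i ∉ D.carrier)
    (hqD : ∀ i ∈ S, q i ∉ D.carrier) (hpcl : ∀ i ∈ S, p i ∈ closure ((D.carrier ∩ T i) \ L i))
    (hqcl : ∀ i ∈ S, q i ∈ closure ((D.carrier ∩ T i) \ L i))
    (hLD : ∀ i ∈ S, L i \ {p i, q i} ⊆ D.carrier) (hBo : ∀ i ∈ S, IsOpen ((D.carrier ∩ T i) \ L i))
    (hBc : ∀ i ∈ S, IsConnected ((D.carrier ∩ T i) \ L i))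
    (hdisj : ∀ i ∈ S, ∀ j ∈ S, i ≠ j → Disjoint (T i) (T j)) :
    ∃ E : DobrushinDomain, E.carrier = D.carrier \ ⋃ i ∈ S, T i ∧ E.pt 0 = D.pt 0 ∧
      E.pt 1 = D.pt 1 := by
  classical
  induction S using Finset.induction_on with
  | empty => exact ⟨D, by simp, rfl, rfl⟩
  | @insert i S hiS ih =>
    obtain ⟨E, hE, hE0, hE1⟩ := ih (fun j hj ↦ hT j (Finset.mem_insert_of_mem hj))
      (fun j hj ↦ ha j (Finset.mem_insert_of_mem hj)) (fun j hj ↦ hb j (Finset.mem_insert_of_mem hj))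
      (fun j hj ↦ hLT j (Finset.mem_insert_of_mem hj)) (fun j hj ↦ hL j (Finset.mem_insert_of_mem hj))
      (fun j hj ↦ hpD j (Finset.mem_insert_of_mem hj)) (fun j hj ↦ hqD j (Finset.mem_insert_of_mem hj))
      (fun j hj ↦ hpcl j (Finset.mem_insert_of_mem hj))
      (fun j hj ↦ hqcl j (Finset.mem_insert_of_mem hj))
      (fun j hj ↦ hLD j (Finset.mem_insert_of_mem hj)) (fun j hj ↦ hBo j (Finset.mem_insert_of_mem hj))
      (fun j hj ↦ hBc j (Finset.mem_insert_of_mem hj))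
      (fun j hj k hk ↦ hdisj j (Finset.mem_insert_of_mem hj) k (Finset.mem_insert_of_mem hk))
    have hi : i ∈ insert i S := Finset.mem_insert_self i S
    -- `T i` misses the bites already removed
    have hTi : ∀ z ∈ T i, z ∉ ⋃ j ∈ S, T j := by
      intro z hz hz'
      simp only [mem_iUnion] at hz'
      obtain ⟨j, hj, hzj⟩ := hz'
      have hij : i ≠ j := fun h ↦ hiS (h ▸ hj)
      exact Set.disjoint_left.1 (hdisj i hi j (Finset.mem_insert_of_mem hj) hij) hz hzj
    have hBi : (E.carrier ∩ T i) \ L i = (D.carrier ∩ T i) \ L i := by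
      rw [hE]
      ext z
      constructor
      · rintro ⟨⟨hz, hzT⟩, hzL⟩; exact ⟨⟨hz.1, hzT⟩, hzL⟩
      · rintro ⟨⟨hz, hzT⟩, hzL⟩; exact ⟨⟨⟨hz, hTi z hzT⟩, hzT⟩, hzL⟩
    have hfrE : ∀ z, z ∉ D.carrier → z ∈ closure ((D.carrier ∩ T i) \ L i) → z ∈ frontier E.carrier := by
      intro z hzD hzcl
      refine ⟨closure_mono ?_ hzcl, fun h ↦ hzD ?_⟩
      · rw [← hBi]; exact fun w hw ↦ hw.1.1
      · have := interior_subset h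
        rw [hE] at this
        exact this.1
    have hLE : L i \ {p i, q i} ⊆ E.carrier := by
      rw [hE]
      exact fun z hz ↦ ⟨hLD i hi hz, hTi z (hLT i hi hz.1)⟩
    obtain ⟨E', hE', hE'0, hE'1⟩ := exists_dobrushin_carrier_eq_diff E (hT i hi) (hE0 ▸ ha i hi)
      (hE1 ▸ hb i hi) (hLT i hi) (hL i hi) (hfrE _ (hpD i hi) (hpcl i hi))
      (hfrE _ (hqD i hi) (hqcl i hi)) hLE (hBi ▸ hBo i hi) (hBi ▸ hBc i hi)
    refine ⟨E', ?_, hE'0.trans hE0, hE'1.trans hE1⟩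
    rw [hE', hE, Finset.set_biUnion_insert, sdiff_sdiff, union_comm]

/-- **Registered helper stub `stub_squeezeBite`** (towards `stub_squeezeFamily`, line `birth`): the bite
lemma `exists_dobrushin_carrier_eq_diff` in closed form. [folklore] -/
theorem stub_squeezeBite :
    ∀ (E : DobrushinDomain) (T L : Set ℂ) (p q : ℂ), IsClosed T → E.pt 0 ∉ T → E.pt 1 ∉ T → L ⊆ T →
      Literature.Topology.PlaneTopology.IsSimpleArc L p q → p ∈ frontier E.carrier →
      q ∈ frontier E.carrier → L \ {p, q} ⊆ E.carrier → IsOpen ((E.carrier ∩ T) \ L) →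
      IsConnected ((E.carrier ∩ T) \ L) →
      ∃ E' : DobrushinDomain, E'.carrier = E.carrier \ T ∧ E'.pt 0 = E.pt 0 ∧ E'.pt 1 = E.pt 1 :=
  fun E _ _ _ _ hT haT hbT hLT hL hp hq hLE hBo hBc ↦
    exists_dobrushin_carrier_eq_diff E hT haT hbT hLT hL hp hq hLE hBo hBc

end Summit.CriticalPhenomena.SAWScalingLimit.Theorems.RestrictionOfLimit.Birth

end
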